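import Summits.QuantumFields.BalabanUV.Beta.GAN24.ScaleNesting

/-!
# `BalabanUV.Beta.FP.PerfectObjects` — road «FP» for binder row D1, leaf N0a/N1 (part 1): the (j, m)-RESOLVENTS as decimated one-shot
# resolvents, and their EXACT STATIONARITY under one more decimation (an index shift), from `GAN24.ScaleNesting.dec_dec` by name

HONEST FRAMING (cell contract, verbatim): «discharging `BetaPertH` makes Bałaban's UV stability UNCONDITIONAL — a real constructive-QFT result;
it is NOT the continuum limit and NOT the Clay problem.»  THIS MODULE DISCHARGES NOTHING: it is two definitions-by-abbreviation over the cell's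
typed `U = 1` objects (`OneStepResolventKernel.KInv`, `OneStepKernelFamily.dec`) and finite-sum identities.  Skeleton:
`HOME/beta/skeletons/D1-b2b-balaban-beta-d1-p3.md` §2–§3 (unit `b2b-balaban-beta-d1-p3`).  NOT BetaPertH, NOT continuum, NOT Clay.

ABSOLUTE RULE (cell, verbatim): «No internally-minted statement may enter as a cited fact. Every hypothesis is either kernel-proved in this package or a
verbatim quotation of a PUBLISHED theorem with page reference.»  Nothing is cited or asserted below.

CONTENT.
* `KTot n M := dec M (KInv (N := n))` — the packed resolvent of the blocking-`n` one-shot `U = 1` system with its field legs decimated by `M`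
  (READING, header clause only: for `n = Lc^(j+m)`, `M = Lc^j` this is the resolvent of the `m`-fold composite step BUILT ON the step-`j`
  system — the «(j, m)-system» of the skeleton; `m = 1` is the cell's `KInvStep Lc j` by `rfl`, `KInvStep_eq_KTot`).
* `dec_KTot : dec P (KTot n M) = KTot n (M * P)` (= `dec_dec`), hence the STATIONARITY IDENTITY AT FINITE LEVEL
  `KTot_shift : dec Lc (KTot (Lc^(j+m+1)) (Lc^j)) = KTot (Lc^(j+m+1)) (Lc^(j+1))` — one more decimation of the (j, m+1)-resolvent IS the
  (j+1, m)-resolvent, EXACTLY; passing to `j → ∞` (leaf N1 of the skeleton: the limit of the shifted sequence is the same limit) this is the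
  fixed-point property `dec Lc (KPerf (m+1)) ≃ KPerf m` of the perfect objects.
* `KInvStep_eq_dec_KTot : KInvStep Lc (j+m) = dec (Lc^m) (KTot (Lc^(j+m+1)) (Lc^j))` — the cell's step resolvent is the FULLY decimated member;
  the (j, m+1)-resolvent is its less-decimated parent (why (CONV-C) for the step family does not by itself name the (j, m)-limits: X1m of the skeleton).
-/

namespace Summit.QuantumFields.BalabanUV.Beta.FP.PerfectObjects

open Literature.MathematicalPhysics.QuantumFieldTheory.Balaban1983to89.Beta
open ExpKernelCalculus (MKer)
open OneStepResolventKernel (Fib KInv)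
open OneStepKernelFamily (dec KInvStep)
open Summit.QuantumFields.BalabanUV.Beta.GAN24.ScaleNesting (dec_dec)

variable {d : ℕ}

/-- [our object] The packed resolvent of the blocking-`n` one-shot `U = 1` system with its field legs decimated by the factor `M`
(`dec M (KInv n)`); for `n = Lc^(j+m)`, `M = Lc^j` the «(j, m)-resolvent» of road FP. -/
noncomputable def KTot (n M : ℕ) [NeZero n] : MKer (d + 1) (Fib d) :=
  dec M (KInv (N := n) (d := d))

/-- [our object] Unfolding. -/
theorem KTot_def (n M : ℕ) [NeZero n] : KTot (d := d) n M = dec M (KInv (N := n) (d := d)) := rfl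

/-- [our object] The cell's decimated composite resolvent is the `m = 1` member: `KInvStep Lc j = KTot (Lc^(j+1)) (Lc^j)`. -/
theorem KInvStep_eq_KTot (Lc : ℕ) [NeZero Lc] (j : ℕ) : KInvStep (d := d) Lc j = KTot (Lc ^ (j + 1)) (Lc ^ j) := rfl

/-- [our object] Decimating further multiplies the decimation factor (`ScaleNesting.dec_dec` by name). -/
theorem dec_KTot (n M P : ℕ) [NeZero n] : dec P (KTot (d := d) n M) = KTot n (M * P) := by
  unfold KTot
  exact dec_dec M P _

/-- [our object] **STATIONARITY AT FINITE LEVEL**: one more `Lc`-decimation of the (j, m+1)-resolvent is the (j+1, m)-resolvent, exactly. -/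
theorem KTot_shift (Lc : ℕ) [NeZero Lc] (j m : ℕ) :
    dec Lc (KTot (d := d) (Lc ^ (j + m + 1)) (Lc ^ j)) = KTot (Lc ^ (j + m + 1)) (Lc ^ (j + 1)) := by
  rw [dec_KTot]
  congr 1

/-- [our object] The cell's step resolvent at level `j + m` is the fully decimated member of the (j, m+1) family. -/
theorem KInvStep_eq_dec_KTot (Lc : ℕ) [NeZero Lc] (j m : ℕ) :
    KInvStep (d := d) Lc (j + m) = dec (Lc ^ m) (KTot (Lc ^ (j + m + 1)) (Lc ^ j)) := by
  rw [KInvStep_eq_KTot, dec_KTot]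
  congr 1
  exact pow_add Lc j m

/-- [our object] Iterated form: `m′` further `Lc`-decimations of the (j, m+m′)-resolvent give the (j+m′, m)-resolvent. -/
theorem KTot_shift_pow (Lc : ℕ) [NeZero Lc] (j m m' : ℕ) :
    dec (Lc ^ m') (KTot (d := d) (Lc ^ (j + m + m' + 1)) (Lc ^ j)) = KTot (Lc ^ (j + m + m' + 1)) (Lc ^ (j + m')) := by
  rw [dec_KTot]
  congr 1
  exact (pow_add Lc j m').symm

end Summit.QuantumFields.BalabanUV.Beta.FP.PerfectObjects
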